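import Mathlib.RingTheory.PrincipalIdealDomain
import Mathlib.Algebra.Polynomial.Degree.SmallDegree
import Mathlib.Algebra.Polynomial.FieldDivision
import Mathlib.Algebra.MvPolynomial.Equiv
import Mathlib.RingTheory.MvPolynomial.Homogeneous
import HarnessLib

/-!
# Polynomials of degree `≤ μ` vanishing to order `μ` at a closed point of the line (CoP1, Lemma 4.3 (2))

Topic: `Literature/AlgebraicGeometry/Resolution`. The one-variable computation behind [CoP1] =
Cossart–Piltant, J. Algebra 320 (2008), Lemma 4.3 (2) ("If `τ(x) = 2` and `Y` is a curve, then
no `x′ ∈ q⁻¹(x)` is near `x`", which "follows easily from (10) and (11)"): in the chart of the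
blowing up of a curve `Y = V(y_1, y_2)`, the weak transform of `f` with `in_x f = F(Y_1, Y_2)`
is `F(1, y_2′)` modulo the ideal of the fibre `q⁻¹(x) ≅ ℙ¹_{k(x)}` ((11), `mod (y_1′, y_3)`),
a non-zero polynomial of degree `≤ μ` in the one fibre variable; `x′` near `x` forces it to
vanish to order `≥ μ` at the point of `x′` on the line. PROVED: this pins the point down to a
RATIONAL point `y_2′ = a` and the polynomial down to `c (y_2′ − a)^μ`:

* `Polynomial.exists_eq_C_mul_X_sub_C_pow_of_mul_mem_pow` — for a field `k`, `g ∈ k[t]`,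
  `g ≠ 0`, `deg g ≤ μ`, `μ ≥ 1`, and a non-zero prime `𝔮` of `k[t]` with `s g ∈ 𝔮^μ` for some
  `s ∉ 𝔮` (i.e. `g ∈ 𝔮^μ k[t]_𝔮`): `𝔮 = (t − a)` and `g = c (t − a)^μ` for some `a, c ∈ k`.

(Hence all initial forms are `c_F (Y_2 − a Y_1)^μ`, `J_x ⊆ k(x)[Y_2 − a Y_1]` and `τ(x) ≤ 1` —
assembled at the level of charts and schemes in later files.)

## Sources

* V. Cossart, O. Piltant, J. Algebra 320 (2008), Lemma 4.3 (2) with (10)–(11), p. 8.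
  [CossartPiltant2008]
-/

noncomputable section

open Polynomial

namespace Literature.AlgebraicGeometry.Resolution

universe u

/-- **A non-zero polynomial of degree `≤ μ` (`μ ≥ 1`) over a field lying in the `μ`-th symbolic
power of a non-zero prime `𝔮` of `k[t]` is `c (t − a)^μ` with `𝔮 = (t − a)`**: `𝔮 = (p)` with
`p` prime, `p^μ ∣ s g` with `p ∤ s` gives `p^μ ∣ g`, and degrees force `deg p = 1`, `g = c p^μ`.
This is the computation behind [CoP1] Lemma 4.3 (2) (a near point over a curve centre would make
every initial form a `μ`-th power of one linear form). [cite: CossartPiltant2008, Lemma 4.3 (2)] -/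
theorem Polynomial.exists_eq_C_mul_X_sub_C_pow_of_mul_mem_pow {k : Type u} [Field k] {g : k[X]}
    (hg0 : g ≠ 0) {μ : ℕ} (hμ : 1 ≤ μ) (hdeg : g.natDegree ≤ μ) (𝔮 : Ideal k[X]) [𝔮.IsPrime]
    (h𝔮 : 𝔮 ≠ ⊥) {s : k[X]} (hs : s ∉ 𝔮) (hsg : s * g ∈ 𝔮 ^ μ) :
    ∃ a c : k, 𝔮 = Ideal.span {X - C a} ∧ g = C c * (X - C a) ^ μ := by
  haveI : 𝔮.IsPrincipal := IsPrincipalIdealRing.principal 𝔮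
  -- `𝔮 = (p)` with `p` prime, and `p^μ ∣ g`
  set p := Submodule.IsPrincipal.generator 𝔮 with hpdef
  have hp : Prime p := Submodule.IsPrincipal.prime_generator_of_isPrime 𝔮 h𝔮
  have h𝔮p : 𝔮 = Ideal.span {p} := (Ideal.span_singleton_generator 𝔮).symm
  have hps : ¬ p ∣ s := by
    rwa [← Submodule.IsPrincipal.mem_iff_generator_dvd 𝔮]
  have hdvd : p ^ μ ∣ g := by
    refine hp.pow_dvd_of_dvd_mul_left μ hps ?_
    rw [← Ideal.mem_span_singleton, ← Ideal.span_singleton_pow, ← h𝔮p]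
    exact hsg
  obtain ⟨q, hq⟩ := hdvd
  have hp0 : p ≠ 0 := hp.ne_zero
  have hq0 : q ≠ 0 := by
    rintro rfl
    exact hg0 (by rw [hq, mul_zero])
  -- degrees: `μ · deg p + deg q = deg g ≤ μ`, `deg p ≥ 1`
  have hdegsum : μ * p.natDegree + q.natDegree ≤ μ := by
    have : g.natDegree = μ * p.natDegree + q.natDegree := by
      rw [hq, natDegree_mul (pow_ne_zero μ hp0) hq0, natDegree_pow]
    omega
  have hp1 : 1 ≤ p.natDegree :=
    Polynomial.natDegree_pos_iff_degree_pos.mpr (degree_pos_of_ne_zero_of_nonunit hp0 hp.not_unit)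
  have hpdeg : p.natDegree = 1 := by
    have h1 : μ * p.natDegree ≤ μ * 1 := by rw [mul_one]; omega
    have := Nat.le_of_mul_le_mul_left h1 (by omega : 0 < μ)
    omega
  have hqdeg : q.natDegree = 0 := by
    have : μ * 1 ≤ μ * p.natDegree := Nat.mul_le_mul_left μ hp1
    omega
  -- `p = a₁ (t − a)`, `q = c₀`
  obtain ⟨a₁, b₁, hpab⟩ := exists_eq_X_add_C_of_natDegree_le_one hpdeg.le
  have ha₁ : a₁ ≠ 0 := by
    rintro rfl
    rw [C_0, zero_mul, zero_add] at hpab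
    rw [hpab, natDegree_C] at hpdeg
    exact zero_ne_one hpdeg
  have hqC : q = C (q.coeff 0) := eq_C_of_natDegree_eq_zero hqdeg
  have hpa : p = C a₁ * (X - C (-(b₁ / a₁))) := by
    rw [hpab, map_neg, sub_neg_eq_add, mul_add, ← C_mul, mul_div_cancel₀ b₁ ha₁]
  refine ⟨-(b₁ / a₁), a₁ ^ μ * q.coeff 0, ?_, ?_⟩
  · rw [h𝔮p, hpa, Ideal.span_singleton_mul_left_unit (Polynomial.isUnit_C.mpr
      (isUnit_iff_ne_zero.mpr ha₁))]
  · calc g = p ^ μ * q := hq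
      _ = (C a₁ * (X - C (-(b₁ / a₁)))) ^ μ * C (q.coeff 0) := by rw [← hpa, ← hqC]
      _ = C (a₁ ^ μ * q.coeff 0) * (X - C (-(b₁ / a₁))) ^ μ := by
        rw [mul_pow, ← C_pow, C_mul]; ring

/-- The degree of the one-variable polynomial attached to `g ∈ k[σ]`, `σ` a singleton, is at
most the total degree of `g`. [folklore] -/
theorem natDegree_uniqueAlgEquiv_le {R : Type u} [CommSemiring R] {σ : Type*} [Unique σ]
    (g : MvPolynomial σ R) : (MvPolynomial.uniqueAlgEquiv R σ g).natDegree ≤ g.totalDegree := by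
  rw [Polynomial.natDegree_le_iff_coeff_eq_zero]
  intro n hn
  rw [MvPolynomial.coeff_uniqueAlgEquiv]
  refine MvPolynomial.coeff_eq_zero_of_totalDegree_lt ?_
  have hn0 : n ≠ 0 := by omega
  rw [Finsupp.support_single _ hn0, Finset.sum_singleton, Finsupp.single_eq_same]
  exact hn

/-- **The same for `k[σ]` with `σ` a singleton** (the fibre ring `k(x)[T_l : l ≠ j]` of the
blowing up of a curve `V(y_1, y_2)` in a threefold has one variable): a non-zero `g` of total
degree `≤ μ`, `μ ≥ 1`, with `s g ∈ 𝔮^μ`, `s ∉ 𝔮`, `𝔮 ≠ 0` prime, is `c (T − a)^μ` with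
`𝔮 = (T − a)`. [cite: CossartPiltant2008, Lemma 4.3 (2)] -/
theorem MvPolynomial.exists_eq_C_mul_X_sub_C_pow_of_mul_mem_pow {k : Type u} [Field k]
    {σ : Type*} [Unique σ] {g : MvPolynomial σ k} (hg0 : g ≠ 0) {μ : ℕ} (hμ : 1 ≤ μ)
    (hdeg : g.totalDegree ≤ μ) (𝔮 : Ideal (MvPolynomial σ k)) [𝔮.IsPrime] (h𝔮 : 𝔮 ≠ ⊥)
    {s : MvPolynomial σ k} (hs : s ∉ 𝔮) (hsg : s * g ∈ 𝔮 ^ μ) :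
    ∃ a c : k, 𝔮 = Ideal.span {MvPolynomial.X default - MvPolynomial.C a} ∧
      g = MvPolynomial.C c * (MvPolynomial.X default - MvPolynomial.C a) ^ μ := by
  let e := MvPolynomial.uniqueAlgEquiv k σ
  have hsurj : Function.Surjective e := e.surjective
  -- transport to `k[X]`
  have hmem : ∀ x, e x ∈ 𝔮.map e ↔ x ∈ 𝔮 := fun x => by
    rw [Ideal.mem_map_iff_of_surjective e hsurj]
    constructor
    · rintro ⟨y, hy, hyx⟩
      rwa [← e.injective hyx]
    · exact fun hx => ⟨x, hx, rfl⟩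
  haveI : (𝔮.map e).IsPrime := Ideal.map_isPrime_of_surjective hsurj (by
    intro x hx
    rw [RingHom.mem_ker] at hx
    rw [(EmbeddingLike.map_eq_zero_iff).mp hx]
    exact 𝔮.zero_mem)
  have h𝔮' : 𝔮.map e ≠ ⊥ := by
    intro h
    apply h𝔮
    rw [eq_bot_iff]
    intro x hx
    have := (hmem x).mpr hx
    rw [h, Ideal.mem_bot, EmbeddingLike.map_eq_zero_iff] at this
    exact (Ideal.mem_bot).mpr this
  have hs' : e s ∉ 𝔮.map e := fun h => hs ((hmem s).mp h)
  have hsg' : e s * e g ∈ (𝔮.map e) ^ μ := by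
    rw [← map_mul, ← Ideal.map_pow]
    exact Ideal.mem_map_of_mem _ hsg
  have hg0' : e g ≠ 0 := fun h => hg0 ((EmbeddingLike.map_eq_zero_iff).mp h)
  have hdeg' : (e g).natDegree ≤ μ := (natDegree_uniqueAlgEquiv_le g).trans hdeg
  obtain ⟨a, c, hq, hg⟩ := Polynomial.exists_eq_C_mul_X_sub_C_pow_of_mul_mem_pow hg0' hμ hdeg'
    (𝔮.map e) h𝔮' hs' hsg'
  -- and back
  have heX : e.symm Polynomial.X = MvPolynomial.X default := by
    change Polynomial.eval₂ MvPolynomial.C (MvPolynomial.X default) Polynomial.X = _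
    rw [Polynomial.eval₂_X]
  have heC : ∀ b : k, e.symm (Polynomial.C b) = MvPolynomial.C b := fun b => by
    change Polynomial.eval₂ MvPolynomial.C (MvPolynomial.X default) (Polynomial.C b) = _
    rw [Polynomial.eval₂_C]
  have hesub : e.symm (Polynomial.X - Polynomial.C a) = MvPolynomial.X default - MvPolynomial.C a := by
    rw [map_sub, heX, heC]
  refine ⟨a, c, ?_, ?_⟩
  · apply le_antisymm
    · intro x hx
      have h1 : e x ∈ Ideal.span {Polynomial.X - Polynomial.C a} := hq ▸ (hmem x).mpr hx
      obtain ⟨r, hr⟩ := Ideal.mem_span_singleton'.mp h1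
      rw [Ideal.mem_span_singleton']
      refine ⟨e.symm r, e.injective ?_⟩
      rw [map_mul, e.apply_symm_apply, ← hesub, e.apply_symm_apply, hr]
    · rw [Ideal.span_singleton_le_iff_mem, ← hmem, hq, ← hesub, e.apply_symm_apply]
      exact Ideal.mem_span_singleton_self _
  · apply e.injective
    rw [hg, map_mul, map_pow, ← hesub, e.apply_symm_apply, ← heC c, e.apply_symm_apply]

end Literature.AlgebraicGeometry.Resolution

end
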